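import Literature.Algebra.EuclideanLattices.GadgetTrapdoor
import Literature.Computability.Cryptography.LeftoverHashMatrix
import HarnessLib

/-!
# The public matrix of Micciancio–Peikert trapdoor generation is statistically close to uniform

Topic `Algebra/EuclideanLattices`, sequel of `GadgetTrapdoor.lean` (MP12 `GenTrap`, statistical
instantiation with tag `I`, `q = 2ᵏ`, trapdoor `R ← U({0,1}^{m̄×nk})`: `trapGenLaw`, `trapGenPubLaw`)
and of `Computability/Cryptography/LeftoverHashMatrix.lean` (leftover hash lemma for a binary
matrix sharing the key: `LeftoverHash.tvDist_mulBitMatrixLaw_uniform_le`). MP12 §5.2: "the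
distribution of `A` is close to uniform … as long as the distribution of `[Ā | 0]T⁻¹ = [Ā | −ĀR]`
is", and for the statistical instantiation "`[Ā | ĀR]` is `δ`-uniform for `δ ≤ (w/2)·√(qⁿ/2^m̄)` by
a version of the leftover hash lemma". Here, PROVED:

* `assemble (Ā, B) = [Ā | G − B]` is a bijection `ℤ_q^{n×m̄} × ℤ_q^{n×nk} → ℤ_q^{n×(m̄ ⊕ nk)}`, and
  `trapGenPubLaw = (law of (Ā, ĀR)).map assemble`;
* **`tvDist_trapGenPubLaw_uniform_le`**: for `k ≥ 1`,
  `Δ(A, U(ℤ_q^{n×(m̄ ⊕ nk)})) ≤ nk · ½ · √(2^{kn} / 2^{m̄})` (`w = nk`, `qⁿ = 2^{kn}`);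
* **`tvDist_trapGenPubLaw_uniform_le_of_le`**: if `m̄ ≥ nk + 2n` then `Δ ≤ (nk/2) / 2ⁿ`.

## References

* D. Micciancio, C. Peikert, *Trapdoors for lattices: simpler, tighter, faster, smaller*,
  EUROCRYPT 2012 (ePrint 2011/501), §5.2 (Alg. 1 and "Statistical instantiation").
  [MicciancioPeikert2012]
-/

noncomputable section

open scoped ENNReal
open Matrix Literature.Computability.Cryptography

namespace Literature.Algebra.EuclideanLattices

variable (n k mbar : ℕ)

/-- The assembling map of `GenTrap`: `(Ā, B) ↦ [Ā | G − B]` (so that `A = assemble (Ā, ĀR)`).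
[cite: MicciancioPeikert2012, §5.2 (Alg. 1)] -/
def assemble (p : Matrix (Fin n) (Fin mbar) (ZMod (2 ^ k)) × Matrix (Fin n) (Fin n × Fin k) (ZMod (2 ^ k))) :
    Matrix (Fin n) (Fin mbar ⊕ (Fin n × Fin k)) (ZMod (2 ^ k)) :=
  Matrix.fromCols p.1 (gadgetMatrix n k - p.2)

/-- `assemble` is a bijection (inverse `A ↦ (A₁, G − A₂)`); in particular it carries the uniform law to
the uniform law. [cite: MicciancioPeikert2012, §5.2 ("the distribution of A is close to uniform … as long as … [Ā | −ĀR] is")] -/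
theorem assemble_bijective : Function.Bijective (assemble n k mbar) := by
  refine ⟨fun p p' h => ?_, fun A => ⟨(A.toCols₁, gadgetMatrix n k - A.toCols₂), ?_⟩⟩
  · have h1 := congrArg Matrix.toCols₁ h
    have h2 := congrArg Matrix.toCols₂ h
    simp only [assemble, toCols₁_fromCols, toCols₂_fromCols, sub_right_inj] at h1 h2
    exact Prod.ext h1 h2
  · simp [assemble]

variable {n k mbar}

/-- The `{0,1}`-matrix of `GadgetTrapdoor.lean` read in `ℤ_q` is `LeftoverHash.bitMatrix`. [folklore] -/
theorem boolMatrix_map_intCast {α β : Type*} (q : ℕ) (B : Matrix α β Bool) :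
    (boolMatrix B).map (Int.cast : ℤ → ZMod q) = LeftoverHash.bitMatrix q B := by
  ext i j
  simp only [boolMatrix, LeftoverHash.bitMatrix, Matrix.map_apply]
  split <;> simp

variable (n k mbar) in
/-- **The public matrix is the assembled leftover-hash pair**: `trapGenPubLaw = (law of (Ā, ĀR)).map assemble`
with `(Ā, ĀR)` distributed as `LeftoverHash.mulBitMatrixLaw (2ᵏ) n m̄ (Fin n × Fin k)`.
[cite: MicciancioPeikert2012, §5.2 (Alg. 1)] -/
theorem trapGenPubLaw_eq_map :
    trapGenPubLaw n k mbar = (LeftoverHash.mulBitMatrixLaw (2 ^ k) n mbar (Fin n × Fin k)).map (assemble n k mbar) := by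
  rw [trapGenPubLaw, trapGenLaw, LeftoverHash.mulBitMatrixLaw, PMF.map_bind, PMF.map_bind]
  refine congrArg _ (funext fun Abar => ?_)
  rw [PMF.map_comp, PMF.map_comp]
  refine congrArg (PMF.map · _) (funext fun B => ?_)
  simp only [Function.comp_apply, assemble, GadgetTrapdoor.pub, GadgetTrapdoor.Rq, boolMatrix_map_intCast]

/-- **MP12 `GenTrap`'s output is statistically close to uniform** (statistical instantiation,
`{0,1}`-uniform trapdoor, `q = 2ᵏ`, `k ≥ 1`): `Δ(A, U(ℤ_q^{n×(m̄ ⊕ nk)})) ≤ nk · ½ · √(2^{kn}/2^{m̄})`,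
i.e. MP12's `δ ≤ (w/2)·√(qⁿ/2^m̄)` with `w = nk`. [cite: MicciancioPeikert2012, §5.2 (statistical instantiation) with Thm. 5.1] -/
theorem tvDist_trapGenPubLaw_uniform_le (hk : 0 < k) :
    (trapGenPubLaw n k mbar).tvDist (PMF.uniformOfFintype _) ≤
      (n * k : ℝ) * (2⁻¹ * Real.sqrt ((2 : ℝ) ^ (k * n) / 2 ^ mbar)) := by
  have hq : 1 < 2 ^ k := Nat.one_lt_two_pow (Nat.pos_iff_ne_zero.1 hk)
  let φ := Equiv.ofBijective _ (assemble_bijective n k mbar)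
  rw [trapGenPubLaw_eq_map, show assemble n k mbar = ⇑φ from rfl, ← PMF.uniformOfFintype_map_equiv φ]
  refine (PMF.tvDist_map_le_holds _ _ _).trans ?_
  have h := LeftoverHash.tvDist_mulBitMatrixLaw_uniform_le (q := 2 ^ k) (k := n) (n := mbar) (κ := Fin n × Fin k) hq
  have hcast : ((2 ^ k : ℕ) : ℝ) ^ n = (2 : ℝ) ^ (k * n) := by push_cast; rw [pow_mul]
  rw [Fintype.card_prod, Fintype.card_fin, Fintype.card_fin, hcast, Nat.cast_mul] at h
  exact h

/-- **Parameters**: with `m̄ ≥ nk + 2n` (the requesting route's choice) the public matrix is within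
`(nk/2)·2⁻ⁿ` of uniform. [cite: MicciancioPeikert2012, §5.2 (statistical instantiation: "m̄ ≥ n lg q + 2 lg(w/2δ)")] -/
theorem tvDist_trapGenPubLaw_uniform_le_of_le (hk : 0 < k) (hm : n * k + 2 * n ≤ mbar) :
    (trapGenPubLaw n k mbar).tvDist (PMF.uniformOfFintype _) ≤ (n * k / 2 : ℝ) / 2 ^ n := by
  refine (tvDist_trapGenPubLaw_uniform_le hk).trans ?_
  have hsqrt : Real.sqrt ((2 : ℝ) ^ (k * n) / 2 ^ mbar) ≤ 1 / 2 ^ n := by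
    rw [show (1 : ℝ) / 2 ^ n = Real.sqrt ((1 / 2 ^ n) ^ 2) by rw [Real.sqrt_sq (by positivity)]]
    refine Real.sqrt_le_sqrt ?_
    rw [div_pow, one_pow, div_le_div_iff₀ (by positivity) (by positivity), one_mul, ← pow_mul, ← pow_add]
    exact pow_le_pow_right₀ (by norm_num) (by nlinarith)
  calc (n * k : ℝ) * (2⁻¹ * Real.sqrt ((2 : ℝ) ^ (k * n) / 2 ^ mbar))
      ≤ (n * k : ℝ) * (2⁻¹ * (1 / 2 ^ n)) := by gcongr
    _ = (n * k / 2 : ℝ) / 2 ^ n := by ring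

end Literature.Algebra.EuclideanLattices

end
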